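import Summits.Ventures.DiscreteObjects.MOLS.IsMOLSSound

/-!
# Completeness of verify-ref's checker `isMOLS`: the census targets ARE certificate statements (kernel glue)
Framing: lottery ticket; floor = certified bounds/negative ranges.

Cell pub-namedobj (venture DiscreteObjects), target (M), designs gen 9.  `IsMOLSSound` proved `isMOLS Ls = true ⇒` the squares
read off `Ls` are Latin and pairwise orthogonal.  Here the converse: **`isMOLS_famList`** — a family `F : Fin m → Fin n → Fin n → Fin n`
of Latin squares, pairwise orthogonal (Literature predicates), written out as lists of rows (`famList F`), passes `isMOLS`.  Hence the
census targets are LITERALLY statements about the existence of a finite certificate accepted by a fixed Bool program: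
**`exists_MOLS_iff_certificate`** (`m` MOLS(n) ⇔ a list of `m` squares with `n` rows each passing `isMOLS`),
**`existsThreeMOLS10_iff_certificate`** (target (M-a)) and **`existsPlaneOrder12_iff_certificate`** (target (M-b), through
`existsPlaneOrder12_iff_eleven_MOLS`).  Glue only; no new mathematics; no `sorry`.
-/

namespace Summit.Ventures.DiscreteObjects.MOLS

open Function List Literature.Combinatorics.Designs.LatinSquares Summit.Ventures.DiscreteObjects.Verify

variable {m n : ℕ}

/-- a square `Fin n → Fin n → Fin n` written as a list of rows of naturals -/
def sqList (S : Fin n → Fin n → Fin n) : List (List ℕ) :=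
  (finRange n).map fun i => (finRange n).map fun j => (S i j : ℕ)

/-- a family of squares written as a list of lists of rows -/
def famList (F : Fin m → Fin n → Fin n → Fin n) : List (List (List ℕ)) :=
  (finRange m).map fun k => sqList (F k)

/-- `sqList S` has `n` rows -/
@[simp] theorem length_sqList (S : Fin n → Fin n → Fin n) : (sqList S).length = n := by
  simp [sqList]

/-- `famList F` lists `m` squares -/
@[simp] theorem length_famList (F : Fin m → Fin n → Fin n → Fin n) : (famList F).length = m := by
  simp [famList]

/-- the members of `famList F` are the listed squares `sqList (F k)` -/
theorem mem_famList {F : Fin m → Fin n → Fin n → Fin n} {L : List (List ℕ)} : L ∈ famList F ↔ ∃ k, L = sqList (F k) := by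
  simp [famList, eq_comm]

/-- the `i`-th row of `sqList S` -/
theorem getElem_sqList (S : Fin n → Fin n → Fin n) {i : ℕ} (hi : i < (sqList S).length) :
    (sqList S)[i] = (finRange n).map fun j => (S ⟨i, by simpa using hi⟩ j : ℕ) := by
  simp [sqList, getElem_finRange]

/-- the row of `i : Fin n`, as `getD` -/
theorem getD_sqList (S : Fin n → Fin n → Fin n) (i : Fin n) :
    (sqList S).getD i [] = (finRange n).map fun j => (S i j : ℕ) := by
  rw [getD_eq_getElem _ _ (by simp), getElem_sqList]

/-- the entries of `sqList S` are the values of `S` -/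
theorem entry_sqList (S : Fin n → Fin n → Fin n) (i j : Fin n) : entry (sqList S) i j = S i j := by
  simp only [entry, getD_sqList]
  rw [getD_eq_getElem _ _ (by simp)]
  simp [getElem_finRange]

/-- an injective row `Fin n → Fin n`, listed, passes `isPerm n` -/
theorem isPerm_map_of_injective {f : Fin n → Fin n} (hf : Injective f) :
    Verify.isPerm n ((finRange n).map fun j => (f j : ℕ)) = true := by
  simp only [Verify.isPerm, Bool.and_eq_true, decide_eq_true_eq, all_eq_true, contains_iff_mem, mem_range, length_map,
    length_finRange, true_and]
  intro s hs
  obtain ⟨j, hj⟩ := Finite.surjective_of_injective hf ⟨s, hs⟩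
  exact mem_map.mpr ⟨j, mem_finRange j, by rw [hj]⟩

/-- the `j`-th column of `sqList S`, listed -/
theorem column_sqList (S : Fin n → Fin n → Fin n) (j : Fin n) :
    column (sqList S) j = (finRange n).map fun i => (S i j : ℕ) := by
  simp only [column, sqList, map_map]
  apply map_congr_left
  intro i _
  simp only [Function.comp]
  rw [getD_eq_getElem _ _ (by simp)]
  simp [getElem_finRange]

/-- **Completeness of `isLatin`:** a Latin square, listed, passes `isLatin`. -/
theorem isLatin_sqList {S : Fin n → Fin n → Fin n} (hS : IsLatinSquare S) : isLatin (sqList S) = true := by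
  rw [isLatin_iff']
  refine ⟨fun r hr => ?_, fun j hj => ?_⟩
  · obtain ⟨i, -, rfl⟩ := mem_map.mp hr
    rw [length_sqList]
    exact isPerm_map_of_injective (hS.1 i)
  · rw [length_sqList] at hj ⊢
    rw [show (j : ℕ) = ((⟨j, hj⟩ : Fin n) : ℕ) from rfl, column_sqList]
    exact isPerm_map_of_injective (hS.2 ⟨j, hj⟩)

/-- **Completeness of `orthogonal`:** orthogonal squares, listed, pass `orthogonal`. -/
theorem orthogonal_sqList {A B : Fin n → Fin n → Fin n} (h : IsOrthogonalMate A B) :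
    Verify.orthogonal (sqList A) (sqList B) = true := by
  simp only [Verify.orthogonal, decide_eq_true_eq, length_sqList]
  rw [nodup_flatMap]
  -- the pair at `(i, j)`, `i, j < n`, is `(A i j, B i j)`
  have hval : ∀ (i j : Fin n), ((sqList A).getD i []).getD j 0 = A i j ∧ ((sqList B).getD i []).getD j 0 = B i j :=
    fun i j => ⟨entry_sqList A i j, entry_sqList B i j⟩
  refine ⟨fun i hi => ?_, ?_⟩
  · rw [mem_range] at hi
    rw [nodup_map_iff_inj_on nodup_range]
    intro j hj j' hj' e
    rw [mem_range] at hj hj'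
    obtain ⟨ha, hb⟩ := hval ⟨i, hi⟩ ⟨j, hj⟩
    obtain ⟨ha', hb'⟩ := hval ⟨i, hi⟩ ⟨j', hj'⟩
    simp only [Prod.mk.injEq] at e
    rw [ha, ha', hb, hb'] at e
    have := @h (⟨i, hi⟩, ⟨j, hj⟩) (⟨i, hi⟩, ⟨j', hj'⟩) (Prod.ext (Fin.ext e.1) (Fin.ext e.2))
    simpa [Fin.ext_iff] using congrArg Prod.snd this
  · refine pairwise_lt_range.imp_of_mem ?_
    intro a b ha hb hab
    rw [mem_range] at ha hb
    refine disjoint_left.mpr fun x hxa hxb => ?_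
    obtain ⟨j, hj, rfl⟩ := mem_map.mp hxa
    obtain ⟨j', hj', e⟩ := mem_map.mp hxb
    rw [mem_range] at hj hj'
    obtain ⟨h1, h2⟩ := hval ⟨a, ha⟩ ⟨j, hj⟩
    obtain ⟨h1', h2'⟩ := hval ⟨b, hb⟩ ⟨j', hj'⟩
    simp only [Prod.mk.injEq] at e
    rw [h1, h1', h2, h2'] at e
    have := @h (⟨b, hb⟩, ⟨j', hj'⟩) (⟨a, ha⟩, ⟨j, hj⟩) (Prod.ext (Fin.ext e.1) (Fin.ext e.2))
    have hba : b = a := by simpa [Fin.ext_iff] using congrArg Prod.fst this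
    omega

/-- **Completeness of `isMOLS`:** a family of pairwise orthogonal Latin squares, listed, passes `isMOLS`. -/
theorem isMOLS_famList {F : Fin m → Fin n → Fin n → Fin n} (hL : ∀ k, IsLatinSquare (F k))
    (hO : ∀ k k', k ≠ k' → IsOrthogonalMate (F k) (F k')) : isMOLS (famList F) = true := by
  rw [isMOLS_iff']
  refine ⟨fun L hL' => ?_, fun a ha b hb hab => ?_⟩
  · obtain ⟨k, rfl⟩ := mem_famList.mp hL'
    exact isLatin_sqList (hL k)
  · rw [length_famList] at ha hb
    have ga : (famList F).getD a [] = sqList (F ⟨a, ha⟩) := by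
      rw [getD_eq_getElem _ _ (by simpa using ha)]; simp [famList, getElem_finRange]
    have gb : (famList F).getD b [] = sqList (F ⟨b, hb⟩) := by
      rw [getD_eq_getElem _ _ (by simpa using hb)]; simp [famList, getElem_finRange]
    rw [ga, gb]
    exact orthogonal_sqList (hO _ _ (by simp [Fin.ext_iff]; omega))

/-! ### The census targets as certificate statements -/

/-- **`m` MOLS(n) exist iff some list certificate passes `isMOLS`.** -/
theorem exists_MOLS_iff_certificate (m n : ℕ) :
    (∃ F : Fin m → Fin n → Fin n → Fin n, (∀ k, IsLatinSquare (F k)) ∧ ∀ k k', k ≠ k' → IsOrthogonalMate (F k) (F k')) ↔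
      ∃ Ls : List (List (List ℕ)), Ls.length = m ∧ (∀ L ∈ Ls, L.length = n) ∧ isMOLS Ls = true := by
  constructor
  · rintro ⟨F, hL, hO⟩
    refine ⟨famList F, length_famList F, fun L hL' => ?_, isMOLS_famList hL hO⟩
    obtain ⟨k, rfl⟩ := mem_famList.mp hL'
    exact length_sqList _
  · rintro ⟨Ls, hm, hlen, h⟩
    exact exists_MOLS_of_isMOLS Ls hm hlen h

/-- **Target (M-a) as a certificate statement:** three MOLS(10) exist iff some list of three squares with 10 rows each passes
verify-ref's `isMOLS`. -/
theorem existsThreeMOLS10_iff_certificate :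
    ExistsThreeMOLS10 ↔ ∃ Ls : List (List (List ℕ)), Ls.length = 3 ∧ (∀ L ∈ Ls, L.length = 10) ∧ isMOLS Ls = true :=
  exists_MOLS_iff_certificate 3 10

/-- **Target (M-b) as a certificate statement:** a projective plane of order 12 exists iff some list of eleven squares with 12
rows each passes verify-ref's `isMOLS`. -/
theorem existsPlaneOrder12_iff_certificate :
    ExistsProjectivePlaneOrder12 ↔ ∃ Ls : List (List (List ℕ)), Ls.length = 11 ∧ (∀ L ∈ Ls, L.length = 12) ∧ isMOLS Ls = true :=
  existsPlaneOrder12_iff_eleven_MOLS.trans (exists_MOLS_iff_certificate 11 12)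

end Summit.Ventures.DiscreteObjects.MOLS
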